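import Mathlib
import HarnessLib
import Summits.KontsevichZagierPeriods.Zeta5Search.SorokinParameterLine

/-!
# ζ(5) search — holomorphy of Zudilin's `J_k` along complex lines of parameters (cell `pub-zeta5`, ct-1 g27)

HONEST FRAMING: systematic search; no irrationality claim unless kernel-certified.  A differentiability statement for a parametric
integral; nothing here is an irrationality result, a worthiness exponent or a denominator statement; no named fact is discharged;
no definition is introduced (integrands inline).

For B6 of `HOME/ct-1/g26/VWP-BLUEPRINT.md` (the two "analytic continuation in the parameters" steps of Zudilin math/0206177): with
`F_t(x) = ∏ x_j^{a_j+tu_j−1}(1−x_j)^{(b_j+tv_j)−(a_j+tu_j)−1} Q_k(x)^{−(a₀+tu₀)}` and the logarithmic weight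
`L(x) = Σ_j(u_j log x_j + (v_j−u_j) log(1−x_j)) − u₀ log Q_k(x)`,

* `hasDerivAt_line` — **`t ↦ ∫_{[0,1]^k} F_t` has the complex derivative `∫_{[0,1]^k} F_0 · L` at `t = 0`**, provided the typed real
  integrand at the perturbed real parts `(Re a₀ + η; Re a_j − η | Re b_j − 2η)` is integrable on `[0,1]^k` for some `η > 0`
  (dominated differentiation, majorant `SorokinParameterLine.norm_deriv_le` on the ball `‖t‖ < η/(2(M+1))`);
* `differentiableAt_line` — the corresponding `DifferentiableAt` statement.

Every direction `(u₀; u | v)` is allowed, so this covers holomorphy in any single parameter `h_i` of Zudilin's (4), where `h_i` enters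
several of `a₀ = h₁, a_j = h_{j+1}, b_j = 1+h₀−h_{j+2}` at once.  Theorems only; imports `Zeta5Search/SorokinParameterLine`.
-/

noncomputable section

namespace Summit.KontsevichZagierPeriods.Zeta5Search.SorokinParameterHolomorphy

open MeasureTheory Set Filter Metric
open scoped Topology
open Literature.NumberTheory.Irrationality.Zudilin2002 (nestedQ sorokinIntegrand)
open Summit.KontsevichZagierPeriods.Zeta5Search.SorokinIntegrandBounds
open Summit.KontsevichZagierPeriods.Zeta5Search.SorokinLastVariable
open Summit.KontsevichZagierPeriods.Zeta5Search.SorokinParameterLine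

/-- Measurability of the logarithmic weight `L`. -/
theorem measurable_L (k : ℕ) (u₀ : ℂ) (u v : ℕ → ℂ) :
    Measurable fun x : Fin k → ℝ =>
      (∑ j : Fin k, (u j * Complex.log ((x j : ℝ) : ℂ) + (v j - u j) * Complex.log (1 - ((x j : ℝ) : ℂ)))) +
        -u₀ * Complex.log ((nestedQ (List.ofFn x) : ℝ) : ℂ) := by
  have hQ : Measurable fun x : Fin k → ℝ => ((nestedQ (List.ofFn x) : ℝ) : ℂ) :=
    Complex.measurable_ofReal.comp (continuous_nestedQ_ofFn k).measurable
  refine (Finset.measurable_sum _ fun j _ => ?_).add ((Complex.measurable_log.comp hQ).const_mul _)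
  have hj : Measurable fun x : Fin k → ℝ => ((x j : ℝ) : ℂ) := Complex.measurable_ofReal.comp (measurable_pi_apply j)
  exact ((Complex.measurable_log.comp hj).const_mul _).add ((Complex.measurable_log.comp (measurable_const.sub hj)).const_mul _)

/-- **Holomorphy of `J_k` along a complex line of parameters** (`k ≥ 1`): if for some `η > 0` the typed real integrand at
`(Re a₀ + η; Re a_j − η | Re b_j − 2η)` is integrable on `[0,1]^k`, then
`t ↦ ∫_{[0,1]^k} ∏ x_j^{a_j+tu_j−1}(1−x_j)^{(b_j+tv_j)−(a_j+tu_j)−1} Q_k^{−(a₀+tu₀)} dx` has at `t = 0` the complex derivative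
`∫_{[0,1]^k} [the integrand at t = 0] · L(x) dx`, `L(x) = Σ_j(u_j log x_j + (v_j−u_j) log(1−x_j)) − u₀ log Q_k(x)`. -/
theorem hasDerivAt_line {k : ℕ} (hk : 1 ≤ k) (a₀ u₀ : ℂ) (a b u v : ℕ → ℂ) {η : ℝ} (hη : 0 < η)
    (hJη : IntegrableOn (sorokinIntegrand k (a₀.re + η) (fun n => (a n).re - η) (fun n => (b n).re - 2 * η))
      (Set.pi univ fun _ : Fin k => Icc (0 : ℝ) 1) volume) :
    HasDerivAt (fun t : ℂ => ∫ x in Set.pi univ (fun _ : Fin k => Icc (0 : ℝ) 1),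
        (∏ j : Fin k, ((x j : ℝ) : ℂ) ^ ((a j + t * u j) - 1) * (1 - ((x j : ℝ) : ℂ)) ^ ((b j + t * v j) - (a j + t * u j) - 1)) *
          ((nestedQ (List.ofFn x) : ℝ) : ℂ) ^ (-(a₀ + t * u₀)))
      (∫ x in Set.pi univ (fun _ : Fin k => Icc (0 : ℝ) 1),
        ((∏ j : Fin k, ((x j : ℝ) : ℂ) ^ (a j - 1) * (1 - ((x j : ℝ) : ℂ)) ^ (b j - a j - 1)) *
            ((nestedQ (List.ofFn x) : ℝ) : ℂ) ^ (-a₀)) *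
          ((∑ j : Fin k, (u j * Complex.log ((x j : ℝ) : ℂ) + (v j - u j) * Complex.log (1 - ((x j : ℝ) : ℂ)))) +
            -u₀ * Complex.log ((nestedQ (List.ofFn x) : ℝ) : ℂ))) 0 := by
  -- names
  set μ : Measure (Fin k → ℝ) := (volume : Measure (Fin k → ℝ)).restrict (Set.pi univ fun _ : Fin k => Icc (0 : ℝ) 1) with hμ
  set F : ℂ → (Fin k → ℝ) → ℂ := fun t x =>
    (∏ j : Fin k, ((x j : ℝ) : ℂ) ^ ((a j + t * u j) - 1) * (1 - ((x j : ℝ) : ℂ)) ^ ((b j + t * v j) - (a j + t * u j) - 1)) *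
      ((nestedQ (List.ofFn x) : ℝ) : ℂ) ^ (-(a₀ + t * u₀)) with hFdef
  set F₀ : (Fin k → ℝ) → ℂ := fun x =>
    (∏ j : Fin k, ((x j : ℝ) : ℂ) ^ (a j - 1) * (1 - ((x j : ℝ) : ℂ)) ^ (b j - a j - 1)) *
      ((nestedQ (List.ofFn x) : ℝ) : ℂ) ^ (-a₀) with hF₀def
  set L : (Fin k → ℝ) → ℂ := fun x =>
    (∑ j : Fin k, (u j * Complex.log ((x j : ℝ) : ℂ) + (v j - u j) * Complex.log (1 - ((x j : ℝ) : ℂ)))) +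
      -u₀ * Complex.log ((nestedQ (List.ofFn x) : ℝ) : ℂ) with hLdef
  set F' : ℂ → (Fin k → ℝ) → ℂ := fun t x => F₀ x * L x * Complex.exp (t * L x) with hF'def
  set M : ℝ := ‖u₀‖ + ∑ j : Fin k, (‖u j‖ + ‖v j - u j‖) with hM
  have hM0 : 0 ≤ M := by positivity
  set ρ : ℝ := η / (2 * (M + 1)) with hρ
  have hρ0 : 0 < ρ := by positivity
  -- a.e. the point lies in the open cube
  have hae : (Set.pi univ fun _ : Fin k => Icc (0 : ℝ) 1) =ᵐ[volume] (Set.pi univ fun _ : Fin k => Ioo (0 : ℝ) 1) := by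
    rw [volume_pi]; exact Measure.pi_Ioo_ae_eq_pi_Icc.symm
  have hopen : ∀ᵐ x ∂μ, ∀ j, x j ∈ Ioo (0 : ℝ) 1 := by
    rw [hμ, Measure.restrict_congr_set hae]
    filter_upwards [ae_restrict_mem (MeasurableSet.univ_pi fun _ => measurableSet_Ioo)] with x hx
    exact fun j => hx j (mem_univ _)
  -- the value at `t = 0`
  have hF0 : F 0 = F₀ := by
    funext x; rw [hFdef, hF₀def]; simp only [zero_mul, add_zero]
  -- measurability in `x`
  have hF_meas : ∀ᶠ t in 𝓝 (0 : ℂ), AEStronglyMeasurable (F t) μ := Eventually.of_forall fun t =>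
    (measurable_integrand k (a₀ + t * u₀) (fun n => a n + t * u n) (fun n => b n + t * v n)).aestronglyMeasurable
  have hF'_meas : AEStronglyMeasurable (F' 0) μ := by
    rw [hF'def]
    exact (((measurable_integrand k a₀ a b).mul (measurable_L k u₀ u v)).mul
      ((measurable_const.mul (measurable_L k u₀ u v)).cexp)).aestronglyMeasurable
  -- integrability at `t = 0` (dominated by the perturbed real integrand)
  have hF_int : Integrable (F 0) μ := by
    rw [hF0]
    refine hJη.mono' (measurable_integrand k a₀ a b).aestronglyMeasurable ?_
    filter_upwards [hopen] with x hx
    have hQ := nestedQ_ofFn_mem_Ioo hk hx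
    rw [hF₀def]
    simp only
    rw [norm_integrand k a₀ a b hx, ← sorokinIntegrand_mul_weight k _ η _ _ hx hQ.1]
    have hS0 : 0 ≤ sorokinIntegrand k a₀.re (fun n => (a n).re) (fun n => (b n).re) x := by
      rw [← norm_integrand k a₀ a b hx]; exact norm_nonneg _
    refine le_mul_of_one_le_right hS0 ?_
    have h1x : ∀ j, 0 < 1 - x j := fun j => by linarith [(hx j).2]
    calc (1 : ℝ) = (∏ _j : Fin k, (1 : ℝ)) * 1 := by simp
      _ ≤ (∏ j : Fin k, x j ^ (-η) * (1 - x j) ^ (-η)) * nestedQ (List.ofFn x) ^ (-η) :=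
        mul_le_mul (Finset.prod_le_prod (fun _ _ => zero_le_one) fun j _ =>
            one_le_mul_of_one_le_of_one_le (one_le_rpow_neg (hx j).1 (hx j).2.le hη.le)
              (one_le_rpow_neg (h1x j) (by linarith [(hx j).1]) hη.le))
          (one_le_rpow_neg hQ.1 hQ.2.le hη.le) zero_le_one
          (Finset.prod_nonneg fun j _ => mul_nonneg (Real.rpow_nonneg (hx j).1.le _) (Real.rpow_nonneg (h1x j).le _))
  -- the bound on the derivative, on the ball `‖t‖ < ρ`
  have h_bound : ∀ᵐ x ∂μ, ∀ t ∈ ball (0 : ℂ) ρ, ‖F' t x‖ ≤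
      M / (η / 2) * sorokinIntegrand k (a₀.re + η) (fun n => (a n).re - η) (fun n => (b n).re - 2 * η) x := by
    filter_upwards [hopen] with x hx t ht
    have ht' : ‖t‖ ≤ η / (2 * ((‖u₀‖ + ∑ j : Fin k, (‖u j‖ + ‖v j - u j‖)) + 1)) := by
      rw [mem_ball, dist_zero_right] at ht; exact ht.le
    rw [hF'def, hF₀def, hLdef]
    exact norm_deriv_le hk a₀ u₀ a b u v hη ht' hx
  have hbound_int : Integrable (fun x => M / (η / 2) *
      sorokinIntegrand k (a₀.re + η) (fun n => (a n).re - η) (fun n => (b n).re - 2 * η) x) μ := hJη.const_mul _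
  -- differentiability of the integrand in `t`
  have h_diff : ∀ᵐ x ∂μ, ∀ t ∈ ball (0 : ℂ) ρ, HasDerivAt (fun t => F t x) (F' t x) t := by
    filter_upwards [hopen] with x hx t _
    have hQ := nestedQ_ofFn_mem_Ioo hk hx
    have hline : (fun t => F t x) = fun t => F₀ x * Complex.exp (t * L x) := by
      funext t
      rw [hFdef, hF₀def, hLdef]
      exact integrand_line_eq a₀ u₀ a b u v t hx hQ.1
    rw [hline]
    show HasDerivAt (fun t => F₀ x * Complex.exp (t * L x)) (F₀ x * L x * Complex.exp (t * L x)) t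
    have h := (((hasDerivAt_id t).mul_const (L x)).cexp).const_mul (F₀ x)
    simp only [id] at h
    exact h.congr_deriv (by ring)
  exact (hasDerivAt_integral_of_dominated_loc_of_deriv_le (ball_mem_nhds (0 : ℂ) hρ0) hF_meas hF_int hF'_meas h_bound
    hbound_int h_diff).2.congr_deriv (by simp only [hF'def, hF₀def, hLdef, zero_mul, Complex.exp_zero, mul_one])

/-- The corresponding differentiability statement. -/
theorem differentiableAt_line {k : ℕ} (hk : 1 ≤ k) (a₀ u₀ : ℂ) (a b u v : ℕ → ℂ) {η : ℝ} (hη : 0 < η)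
    (hJη : IntegrableOn (sorokinIntegrand k (a₀.re + η) (fun n => (a n).re - η) (fun n => (b n).re - 2 * η))
      (Set.pi univ fun _ : Fin k => Icc (0 : ℝ) 1) volume) :
    DifferentiableAt ℂ (fun t : ℂ => ∫ x in Set.pi univ (fun _ : Fin k => Icc (0 : ℝ) 1),
        (∏ j : Fin k, ((x j : ℝ) : ℂ) ^ ((a j + t * u j) - 1) * (1 - ((x j : ℝ) : ℂ)) ^ ((b j + t * v j) - (a j + t * u j) - 1)) *
          ((nestedQ (List.ofFn x) : ℝ) : ℂ) ^ (-(a₀ + t * u₀))) 0 :=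
  (hasDerivAt_line hk a₀ u₀ a b u v hη hJη).differentiableAt

end Summit.KontsevichZagierPeriods.Zeta5Search.SorokinParameterHolomorphy

end
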